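import Literature.LinearAlgebra.Matrix.UnitarySingularLocusNull                   -- ★ p851769 (this seat): the singular set of `U(σ, J)(K)` is Haar-null (model level)
import Literature.NumberTheory.Automorphic.UnitaryCartanRegularAE                  -- ★ p851336: scalar inputs `δ`, `ε_k` at `E_w`; the one-place transport idiom
import Literature.NumberTheory.Automorphic.HermitianFormNonsplitPlaceFrame         -- ★ `placeForm_antidiag_three`
import Literature.NumberTheory.Rogawski1990.CMLocalAPacketMembers                  -- ★ `Gqs L v = U(Φ₃)(L⁺_v)`, `qsForm`
import HarnessLib

/-!
# F0 · P3c · line LH6 «StCharTS» — (J8) «SINGULAR-NULL-G»: the singular set of `U(Φ₃)(L⁺_v)` is Haar-null at every non-split place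
# [HarishChandra1970, Lemma 42; Rogawski1990, §12.5 p. 182]

Cell `pub/hodgecm-mathlib`, crux H413 = `stmt-HodgeConjecture-24833` (lane `--supports …`, count-neutral), route HCCMUnconditional; seat LH5-p03 (g6) on the
JAC-LOC road of LH6-p03 (g5) (`F0/P3b/LH6-p03/g5/ROAD-JAC-LOC.v1.LH6p03g5.md` §2 brick (J8), dealt 2026-09-02T14:27:35Z).  THEOREMS ONLY (no definition ∕
instance ∕ notation ∕ named fact ∕ `sorry`); ★-only imports.

WHAT.  The FULL Weyl integration formula of the (S-𝔇) organ `stub_EllipticPackage` (★ `Ch12Sec5.EllipticData.WeylIntegrationFormula`: `∫_G f·α dg = Σ_T …` for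
class functions `α` on `G^r`) needs «the complement of the regular set `G^r` is `dg`-null» on the GROUP `G = U(Φ₃)(L⁺_v)` — not only on each Cartan subgroup
(★ `F0P3cStCharTSCartanNull∕Discharge`, whose Steinhaus-on-subgroups device does not apply: the singular set of `G` is not a union of subgroups).  Here:
* `measure_setOf_not_isRegularElt_local_eq_zero` — for `E ∕ F` CM-type data (`c ≠ 1`), a place `w ∣ v` with `c • w = w` and `J ∈ M₃(E)` whose one-place form
  `J_w` is congruent over `E_w` to a DIAGONAL form (`formCongr σ_w T J_w = diag h`): for every Haar measure `ν` on `U(J)(F_v) = «local» E c 3 J v`,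
  `ν {g | ¬ IsRegularElt g} = 0` (★ `Literature.LinearAlgebra.Matrix.exists_closed_null_superset_singular` in the one-place model `U(σ_w, J_w)(E_w)` — a
  genuine local field of characteristic `0` — transported along ★ `localNonsplitEquiv`; regularity ↔ separability ★ `isRegularElt_iff_charpoly_separable_localNonsplitEquiv`);
* `formCongr_quasiSplitFrame_eq_diagonal` — the rational frame `P = [[1,0,1],[0,1,0],[1,0,−1]]` diagonalises `Φ₃ = antidiag(1,1,1)`: `ᵗP Φ₃ P = diag(2, 1, −2)`;
* **`measure_setOf_not_isRegularElt_Gqs_eq_zero`** — THE (J8) HEAD as lettered: at a non-split `v` (`w`, `hw`), for every Haar measure `ν` on `Gqs L v`,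
  `ν {g : Gqs L v | ¬ IsRegularElt g.val} = 0`; and the `hns`-form `measure_setOf_not_isRegularElt_Gqs_eq_zero_of_forall` / a.e. form `ae_isRegularElt_Gqs`.
ROAD (LH5-p03 (g6), chart-free): parameter torus `u = x∕σx` (push-forward of additive Haar; atomless by additive Steinhaus), shear along `P·diag(u)·P⁻¹`, cubic
discriminant polynomial `D` with `{¬regular} ⊆ {D = 0}` closed and every fibre the zero set of a NON-ZERO polynomial in `u` (★ `MvPolynomialZeroSetNull`,
★ `CubicDiscriminantDiagonalScaling`).
HONEST LABEL.  Count-neutral helper: pays no organ by itself (it removes the «singular-null» input of the FULL WIF on the JAC-LOC ∕ RUNG0 roads).  HC_CM is proved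
only modulo the 7 printed citations (2 remaining named inputs: hLiu418 = `stmt-HodgeConjecture-24832`, h413 = `stmt-HodgeConjecture-24833`) until rung 0 closes.

## References
* [HarishChandra1970] Harish-Chandra (notes by G. van Dijk), *Harmonic Analysis on Reductive p-adic Groups*, LNM 162 (1970), Lemma 42.
* [Rogawski1990] J. D. Rogawski, *Automorphic Representations of Unitary Groups in Three Variables*, Ann. of Math. Stud. 123 (1990), §12.5 p. 182; §12.2 p. 173 (`Φ₃`).
* [PlatonovRapinchuk1994] V. Platonov, A. Rapinchuk, *Algebraic Groups and Number Theory* (1994), §2.3, §5.1 (one-place model, congruent forms).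
-/

set_option autoImplicit false
-- the mandated namespace has the single-problem summit's repeated segment (`HodgeConjecture.HodgeConjecture`)
set_option linter.dupNamespace false

noncomputable section

open NumberField IsDedekindDomain MeasureTheory Filter Topology
open scoped Matrix MatrixGroups
open Literature.NumberTheory.Rogawski1990 Literature.NumberTheory.Automorphic Literature.NumberTheory.Automorphic.UnitaryGroup

namespace Summit.HodgeConjecture.HodgeConjecture.Cruxes.H413.F0P3cStCharTSSingularNull

/-! ## §1 Any `J` whose one-place form is congruent to a diagonal form, on the matrix carrier `U(J)(F_v)` -/

section Local

variable {F E : Type} [Field F] [NumberField F] [Field E] [NumberField E] [Algebra F E] [Algebra.IsQuadraticExtension F E]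
  (c : E ≃ₐ[F] E) (J : Matrix (Fin 3) (Fin 3) E) {v : HeightOneSpectrum (𝓞 F)} (hc : c ≠ 1)
  (w : PlacesOver E v) (hw : c • w.1 = w.1)

include hc in
/-- **The singular set of `U(J)(F_v)` is Haar-null** (`v` non-split: `c • w = w`; `J_w` congruent over `E_w` to a diagonal form, `ᵗσ_w(T)·J_w·T = diag h`): for every
Haar measure `ν` on `«local» E c 3 J v`, the non-regular-semisimple elements form a `ν`-null set.  ★ `exists_closed_null_superset_singular` in the one-place model
`U(σ_w, J_w)(E_w)` (a characteristic-`0` local field: locally compact, second countable, `σ_w` a continuous involution with a non-fixed element and the fixed null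
sequence `ϖ^k`), transported along ★ `localNonsplitEquiv` (Haar goes to Haar; regular ↔ separable `w`-component). [cite: HarishChandra1970, Lemma 42]
[cite: Rogawski1990, §12.5 p. 182] -/
theorem measure_setOf_not_isRegularElt_local_eq_zero {T : GL (Fin 3) (w.1.adicCompletion E)} {h : Fin 3 → w.1.adicCompletion E}
    (hT : formCongr (galAdicCompletionMap (L := E) c hw) T (placeForm J w.1) = Matrix.diagonal h)
    [MeasurableSpace («local» E c 3 J v)] [BorelSpace («local» E c 3 J v)]
    (ν : Measure («local» E c 3 J v)) [ν.IsHaarMeasure] :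
    ν {g : «local» E c 3 J v | ¬ IsRegularElt (g : GL (Fin 3) (LocalRing E v))} = 0 := by
  letI : MeasurableSpace (w.1.adicCompletion E) := borel _
  haveI : BorelSpace (w.1.adicCompletion E) := ⟨rfl⟩
  haveI : SecondCountableTopology (w.1.adicCompletion E) := secondCountableTopology_adicCompletion E w.1
  haveI : CharZero (w.1.adicCompletion E) := charZero_of_injective_algebraMap (algebraMap E (w.1.adicCompletion E)).injective
  -- the scalar inputs at `E_w`
  have hσc : Continuous (galAdicCompletionMap (L := E) c hw) := continuous_galAdicCompletionMap E c hw
  have hσσ : ∀ x, galAdicCompletionMap (L := E) c hw (galAdicCompletionMap (L := E) c hw x) = x :=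
    galAdicCompletionMap_galAdicCompletionMap_of_smul_eq c w hc hw
  obtain ⟨δ, hσδ, hδ⟩ := exists_skew_ne_zero_adicCompletion c hc w hw
  have ha : galAdicCompletionMap (L := E) c hw δ ≠ δ := by
    rw [hσδ]
    intro hneg
    apply hδ
    have h2 : (2 : w.1.adicCompletion E) * δ = 0 := by linear_combination -hneg
    exact (mul_eq_zero.mp h2).resolve_left two_ne_zero
  obtain ⟨ε, hε, hε0, hσε⟩ := exists_null_seq_fixed_adicCompletion c hc w hw
  -- the one-place model and the transport
  letI : MeasurableSpace ↥(unitaryGroupOfForm (galAdicCompletionMap (L := E) c hw) (placeForm J w.1)) := borel _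
  haveI : BorelSpace ↥(unitaryGroupOfForm (galAdicCompletionMap (L := E) c hw) (placeForm J w.1)) := ⟨rfl⟩
  obtain ⟨S, hSc, hSsing, hSnull⟩ :=
    Literature.LinearAlgebra.Matrix.exists_closed_null_superset_singular (galAdicCompletionMap (L := E) c hw) hσc hσσ ha hε hε0 hσε hT
  set e := localNonsplitEquiv c J hc w hw with he
  haveI : (ν.map e).IsHaarMeasure := ContinuousMulEquiv.isHaarMeasure_map ν e
  have h1 := hSnull (ν.map e) inferInstance
  have hm : Measurable (e : «local» E c 3 J v → ↥(unitaryGroupOfForm (galAdicCompletionMap (L := E) c hw) (placeForm J w.1))) :=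
    e.continuous.measurable
  rw [Measure.map_apply hm hSc.measurableSet] at h1
  refine measure_mono_null (fun g hg => ?_) h1
  exact hSsing (e g) fun hsep => hg ((isRegularElt_iff_charpoly_separable_localNonsplitEquiv c 3 J hc w hw g).2 hsep)

end Local

/-! ## §2 The quasi-split form `Φ₃`: the (J8) head on `Gqs L v` -/

section Frame

/-- The frame identity `ᵗP·Φ₃·P = diag(2, 1, −2)` over any commutative ring, `P = [[1,0,1],[0,1,0],[1,0,−1]]`, `Φ₃ = antidiag(1,1,1)`.
[cite: Rogawski1990, §12.2 p. 173] -/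
theorem quasiSplitFrame_transpose_mul_antidiag_mul {R : Type*} [CommRing R] :
    (!![(1 : R), 0, 1; 0, 1, 0; 1, 0, -1] : Matrix (Fin 3) (Fin 3) R)ᵀ *
        (Matrix.of fun i j : Fin 3 => if i.val + j.val + 1 = 3 then (1 : R) else 0) * !![(1 : R), 0, 1; 0, 1, 0; 1, 0, -1] =
      Matrix.diagonal ![2, 1, -2] := by
  ext i j
  fin_cases i <;> fin_cases j <;>
    simp [Matrix.mul_apply, Fin.sum_univ_three, Matrix.transpose_apply, Matrix.of_apply, Matrix.diagonal] <;> norm_num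

variable (L : Type) [Field L] [NumberField L] [IsCMField L]

omit [IsCMField L] in
/-- **The rational frame diagonalising `Φ₃`**: over the local field `L_w` (characteristic `0`) the matrix `P = [[1,0,1],[0,1,0],[1,0,−1]]` (columns `e₁ + e₃`,
`e₂`, `e₁ − e₃`) is invertible (`det P = −2`). [cite: Rogawski1990, §12.2 p. 173] -/
theorem det_quasiSplitFrame (w : HeightOneSpectrum (𝓞 L)) :
    (!![(1 : w.adicCompletion L), 0, 1; 0, 1, 0; 1, 0, -1] : Matrix (Fin 3) (Fin 3) (w.adicCompletion L)).det ≠ 0 := by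
  haveI : CharZero (w.adicCompletion L) := charZero_of_injective_algebraMap (algebraMap L (w.adicCompletion L)).injective
  rw [Matrix.det_fin_three]
  simp
  norm_num

/-- **`ᵗσ_w(P)·Φ₃·P = diag(2, 1, −2)`** for the rational frame `P` (its entries `0, ±1` are `σ_w`-fixed) and the local quasi-split form `(Φ₃)_w = antidiag(1,1,1)` at a
place `w` fixed by complex conjugation. [cite: Rogawski1990, §12.2 p. 173] [cite: PlatonovRapinchuk1994, §2.3] -/
theorem formCongr_quasiSplitFrame_eq_diagonal (w : HeightOneSpectrum (𝓞 L)) (hw : IsCMField.complexConj L • w = w) :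
    formCongr (galAdicCompletionMap (L := L) (IsCMField.complexConj L) hw)
        (Matrix.GeneralLinearGroup.mkOfDetNeZero
          (!![(1 : w.adicCompletion L), 0, 1; 0, 1, 0; 1, 0, -1] : Matrix (Fin 3) (Fin 3) (w.adicCompletion L)) (det_quasiSplitFrame L w))
        (placeForm (qsForm L) w) =
      Matrix.diagonal ![2, 1, -2] := by
  have hP : (!![(1 : w.adicCompletion L), 0, 1; 0, 1, 0; 1, 0, -1] : Matrix (Fin 3) (Fin 3) (w.adicCompletion L)).map
      (galAdicCompletionMap (L := L) (IsCMField.complexConj L) hw) = !![(1 : w.adicCompletion L), 0, 1; 0, 1, 0; 1, 0, -1] := by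
    ext i j
    fin_cases i <;> fin_cases j <;> simp
  have hval : ((Matrix.GeneralLinearGroup.mkOfDetNeZero
      (!![(1 : w.adicCompletion L), 0, 1; 0, 1, 0; 1, 0, -1] : Matrix (Fin 3) (Fin 3) (w.adicCompletion L)) (det_quasiSplitFrame L w) :
        GL (Fin 3) (w.adicCompletion L)) : Matrix (Fin 3) (Fin 3) (w.adicCompletion L)) =
      !![(1 : w.adicCompletion L), 0, 1; 0, 1, 0; 1, 0, -1] := rfl
  have hform : placeForm (qsForm L) w = Matrix.of fun i j : Fin 3 => if i.val + j.val + 1 = 3 then (1 : w.adicCompletion L) else 0 :=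
    HermitianFrame.placeForm_antidiag_three L w
  dsimp only [formCongr]
  rw [hval, hform, hP]
  exact quasiSplitFrame_transpose_mul_antidiag_mul

end Frame

section U3

variable (L : Type) [Field L] [NumberField L] [IsCMField L] (v : HeightOneSpectrum (𝓞 ↥(maximalRealSubfield L)))

/-- **(J8) «SINGULAR-NULL-G» — THE SINGULAR SET OF `U(Φ₃)(L⁺_v)` IS HAAR-NULL** at a non-split place (`w ∣ v` fixed by complex conjugation): for every Haar
measure `ν` on `Gqs L v = U(Φ₃)(L⁺_v)`, `ν {g | ¬ IsRegularElt g} = 0` — the input «the complement of `G^r` has measure zero» of the FULL Weyl integration formula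
[Rogawski1990 §12.5 p. 182].  §1 at `J = Φ₃` with the rational frame `P`. [cite: HarishChandra1970, Lemma 42] [cite: Rogawski1990, §12.5 p. 182] -/
theorem measure_setOf_not_isRegularElt_Gqs_eq_zero (w : PlacesOver L v) (hw : IsCMField.complexConj L • w.1 = w.1)
    [instM : MeasurableSpace (Gqs L v)] [instB : BorelSpace (Gqs L v)] (ν : Measure (Gqs L v)) [hν : ν.IsHaarMeasure] :
    ν {g : Gqs L v | ¬ IsRegularElt (g.val : GL (Fin 3) (UnitaryGroup.LocalRing L v))} = 0 :=
  @measure_setOf_not_isRegularElt_local_eq_zero _ _ _ _ _ _ _ _ (IsCMField.complexConj L) (qsForm L) v (IsCMField.complexConj_ne_one L) w hw _ _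
    (formCongr_quasiSplitFrame_eq_diagonal L w.1 hw) instM instB ν hν

/-- The same with the organ's first binder `hns : ∀ w ∣ v, c • w = w` (non-split `v`). [cite: HarishChandra1970, Lemma 42] [cite: Rogawski1990, §12.5 p. 182] -/
theorem measure_setOf_not_isRegularElt_Gqs_eq_zero_of_forall (hns : ∀ w : PlacesOver L v, IsCMField.complexConj L • w.1 = w.1)
    [MeasurableSpace (Gqs L v)] [BorelSpace (Gqs L v)] (ν : Measure (Gqs L v)) [ν.IsHaarMeasure] :
    ν {g : Gqs L v | ¬ IsRegularElt (g.val : GL (Fin 3) (UnitaryGroup.LocalRing L v))} = 0 := by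
  obtain ⟨w⟩ : Nonempty (PlacesOver L v) := inferInstance
  exact measure_setOf_not_isRegularElt_Gqs_eq_zero L v w (hns w) ν

/-- **Haar-almost every element of `U(Φ₃)(L⁺_v)` is regular** (non-split `v`) — the a.e. form the Weyl integration formula consumes (restricting `∫_G` to `G^r`).
[cite: HarishChandra1970, Lemma 42] [cite: Rogawski1990, §12.5 p. 182] -/
theorem ae_isRegularElt_Gqs (w : PlacesOver L v) (hw : IsCMField.complexConj L • w.1 = w.1)
    [MeasurableSpace (Gqs L v)] [BorelSpace (Gqs L v)] (ν : Measure (Gqs L v)) [ν.IsHaarMeasure] :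
    ∀ᵐ g : Gqs L v ∂ν, IsRegularElt (g.val : GL (Fin 3) (UnitaryGroup.LocalRing L v)) := by
  rw [ae_iff]
  exact measure_setOf_not_isRegularElt_Gqs_eq_zero L v w hw ν

end U3

end Summit.HodgeConjecture.HodgeConjecture.Cruxes.H413.F0P3cStCharTSSingularNull

end
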